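import Summits.CriticalPhenomena.PercolationContinuityZ3.Theorems.Transplant.CayleyZ2RotC4QuasiInputs
import Summits.CriticalPhenomena.PercolationContinuityZ3.Theorems.Transplant.PlanarSkeletonFrmQuasiProxies
import Literature.Probability.Percolation.GrimmettMarstrand
import HarnessLib

/-!
# The rotor square lattice `X = Cay(ℤ² ⋊ C₄; ρ, x)` IS a customer of the quasi-step carrier: an explicit `PlanarSkeletonFrmQuasi X` (position chart, `M = 3`,
# `W = 0`), proxies at radius `2`, FINITE cylinders (Φ2 free) — so the row-94 witness against every single-edge carrier becomes the first concrete
# customer of the (N3-b) node, hypothesis-free modulo the node itself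

builds on p205010 (kernel theorem, internal audit signed; external expert review pending) — nothing in this file uses p205010; NOTHING is claimed about any
node: the node statement enters only as the hypothesis binder `hNode` of §3 (name and words are the lead's).  Lane `prim-bschramm`, seat `prim-bschramm-p5`
gen 28 (refuter / sharpness seat; P5-SHARPNESS row 94 / §60).  Helper file (`--supports stmt-CriticalPhenomena-4575 --as helper`): ONE definition
(`Z2Rot.rotorSkeleton`) and its consequences.

WHY.  p5-g27 proved that `X` admits NO single-edge-step chart at all (`Z2Rot.no_singleEdgeStep_chart`, p495173: `IsEmpty (PlanarSkeletonFrmScaled X)`), and typed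
its quasi-inputs (`rotor_psiLip`, `rotor_psiFrames`, `rotor_psiSteps`, `boxCyl_connected`, p497676).  With the design owner's carrier «PlanarSkeletonFrmQuasiDefs»
(p507026, step field (ι) := `Skelφ.QStepsN`) `X` is a customer ON THE NOSE: §1 `rotor_qStepsN : Skelφ.QStepsN X Prod.fst 3` (turn ≤ twice at constant position, then
move: EXACT footprint); §2 **`rotorSkeleton : PlanarSkeletonFrmQuasi X`** (φ = position, 1-Lipschitz, four types `(0, k)`, frames = translations, Δ = 4, M = 3,
ℓ₀ = 0, W = 0 — box cylinders are connected outright), **`rotorSkeleton_hasProxies : HasProxies (0,k) 2`** (proxy of `(v, j)` = `(v, k)`, framed by `shiftIso v`,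
two turns away), **`rotorSkeleton_cylSubcritical : CylSubcritical p` for EVERY `p`** (cylinders are finite: box × four headings); §3 **`criticalContinuity_of_quasiNode
(hNode) : ∀ v, θ_v(p_c(X)) = 0`** and `conj4_of_quasiNode` (`p_c < 1 ∧ θ_v(p_c) = 0`, with p496890's `rotor_criticalProb_lt_one`) — every hypothesis of the node
discharged in the kernel for `X`; θ(p_c) of `X` is not in print (P5-SHARPNESS §59.8: non-planar, four one-dimensional layers).
[cite: BenjaminiSchramm1996, Conj. 4; §2 (almost transitive graphs)] [cite: KozmaNitzan2024, §4 p. 16 (Lemma 8), p. 19 (Step III)]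
-/

noncomputable section

namespace Summit.CriticalPhenomena.PercolationContinuityZ3.Theorems.Transplant

open Literature.Probability.Percolation Literature.Probability.LatticeModels SimpleGraph
open scoped Classical

namespace Z2Rot

/-! ## §1 Exact-footprint quasi-steps of length `3` -/

/-- **`X` HAS EXACT-FOOTPRINT QUASI-STEPS OF COST `3` — `Skelφ.QStepsN X Prod.fst 3`**: turn (≤ 2 edges, position fixed), then move once; every vertex of the
walk is at the start position or is the far end. [this work] -/
theorem rotor_qStepsN : Skelφ.QStepsN graph (Prod.fst : Vtx → Site 2) 3 := by
  rintro ⟨v, k⟩ i σ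
  obtain ⟨k', hk'⟩ := exists_dir_eq_single i σ
  obtain ⟨p, hp, hs⟩ := exists_turnWalk v k k'
  refine ⟨(v + dir k', k'), by rw [hk'], p.append (Walk.cons (adj_move v k') Walk.nil), ?_, fun u hu => ?_⟩
  · rw [Walk.length_append, Walk.length_cons, Walk.length_nil]; omega
  · rw [Walk.mem_support_append_iff] at hu
    rcases hu with hu | hu
    · exact Or.inl (hs u hu)
    · rw [Walk.support_cons, Walk.support_nil, List.mem_cons, List.mem_singleton] at hu
      rcases hu with rfl | rfl
      · exact Or.inl rfl
      · exact Or.inr rfl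

/-! ## §2 The quasi-step carrier of `X`, its proxies, its finite cylinders -/

/-- **THE QUASI-STEP CARRIER OF THE ROTOR LATTICE**: position chart, four types, translation frames, degree `4`, exact-footprint quasi-steps of cost `3`, box
cylinders connected from width `0` with no fattening. [this work] -/
def rotorSkeleton : PlanarSkeletonFrmQuasi graph where
  φ := Prod.fst
  lip := rotor_psiLip
  types := types
  frame := rotor_psiFrames
  Δ := 4
  degree_le := degree_le
  M := 3
  qstep := rotor_qStepsN
  ℓ₀ := 0
  W := 0
  cyl_reach := by
    intro t ht ℓ _ u v hu hv
    -- `t = (0, k)`: the cylinder is the box cylinder, connected outright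
    have ht0 : t.1 = 0 := by
      simp only [types, Finset.mem_insert, Finset.mem_singleton] at ht
      rcases ht with rfl | rfl | rfl | rfl <;> rfl
    have key : ∀ S : Set Vtx, S = boxCyl ℓ → u ∈ boxCyl ℓ → v ∈ boxCyl ℓ →
        ∃ (hu : u ∈ S) (hv : v ∈ S), (graph.induce S).Reachable ⟨u, hu⟩ ⟨v, hv⟩ := by
      rintro S rfl hu hv
      exact ⟨hu, hv, (boxCyl_connected ℓ).preconnected ⟨u, hu⟩ ⟨v, hv⟩⟩
    refine key _ ?_ ?_ ?_
    · ext w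
      show w.1 - t.1 ∈ box 2 (ℓ + 0) ↔ w.1 ∈ box 2 ℓ
      rw [ht0, sub_zero, Nat.add_zero]
    · show u.1 ∈ box 2 ℓ
      have h : u.1 - t.1 ∈ box 2 ℓ := hu
      rwa [ht0, sub_zero] at h
    · show v.1 ∈ box 2 ℓ
      have h : v.1 - t.1 ∈ box 2 ℓ := hv
      rwa [ht0, sub_zero] at h

/-- The carrier's chart is the position. [folklore] -/
@[simp] theorem rotorSkeleton_φ : rotorSkeleton.φ = (Prod.fst : Vtx → Site 2) := rfl

/-- The carrier's types are the four headings at the origin. [folklore] -/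
@[simp] theorem rotorSkeleton_types : rotorSkeleton.types = types := rfl

/-- **PROXIES AT RADIUS `2`** for every type `(0, k)`: the proxy of `c = (v, j)` is `(v, k)` — same position, framed from `(0, k)` by the translation `shiftIso v`,
two turn edges away from `c`. [this work] -/
theorem rotorSkeleton_hasProxies (k : Fin 4) : rotorSkeleton.HasProxies (((0 : Site 2), k) : Vtx) 2 := by
  rintro ⟨v, j⟩
  refine ⟨(v, k), shiftIso v, ?_, fun w => ?_, rfl, ?_⟩
  · show ((0 : Site 2) + v, k) = (v, k)
    rw [zero_add]
  · show w.1 + v = w.1 + (v - (0 : Site 2))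
    rw [sub_zero]
  · obtain ⟨p, hp, -⟩ := exists_turnWalk v k j
    exact ⟨p, hp⟩

/-- **THE CYLINDERS OF `X` ARE FINITE, so `CylSubcritical p` holds at EVERY density `p`** (a finite graph has `θ = 0`). [folklore] -/
theorem rotorSkeleton_cylSubcritical (p : unitInterval) : rotorSkeleton.CylSubcritical p := by
  intro t ht ℓ
  have hfin : ({w : Vtx | w.1 - t.1 ∈ box 2 ℓ} : Set Vtx).Finite := by
    refine (Set.Finite.prod (s := (↑((box 2 ℓ).image fun x : Site 2 => x + t.1) : Set (Site 2))) (t := (Set.univ : Set (Fin 4)))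
      (Finset.finite_toSet _) Set.finite_univ).subset ?_
    intro w hw
    refine Set.mem_prod.2 ⟨?_, Set.mem_univ _⟩
    rw [Finset.coe_image]
    exact ⟨w.1 - t.1, hw, sub_add_cancel _ _⟩
  haveI : Finite ↥({w : Vtx | w.1 - t.1 ∈ box 2 ℓ} : Set Vtx) := hfin.to_subtype
  show theta (graph.induce {w : Vtx | w.1 - t.1 ∈ box 2 ℓ}) _ p = 0
  exact Literature.Probability.Percolation.theta_eq_zero_of_finite _ _ p

/-! ## §3 The rotor lattice as a customer of the quasi-step node -/

/-- **`θ_v(p_c) = 0` AT EVERY VERTEX OF THE ROTOR LATTICE, from the quasi-step node alone** (every hypothesis — type, proxies, subcritical cylinders — discharged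
above; transport from the type `(0, k)` to `v` by the translation frame). [cite: BenjaminiSchramm1996, Conj. 4] -/
theorem criticalContinuity_of_quasiNode
    (hNode : ∀ {W : Type} (G : SimpleGraph W) [G.LocallyFinite] (Φ : PlanarSkeletonFrmQuasi G) (t : W) (D : ℕ),
      t ∈ Φ.types → Φ.HasProxies t D → Φ.CylSubcritical (criticalProbIOf G t) → theta G t (criticalProbIOf G t) = 0)
    (v : Vtx) : theta graph v (criticalProbIOf graph v) = 0 := by
  have ht : (((0 : Site 2), v.2) : Vtx) ∈ rotorSkeleton.types := mem_types v.2
  have h0 := hNode graph rotorSkeleton _ 2 ht (rotorSkeleton_hasProxies v.2) (rotorSkeleton_cylSubcritical _)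
  have e1 := theta_iso (shiftIso v.1) (((0 : Site 2), v.2) : Vtx) (criticalProbIOf graph ((0 : Site 2), v.2))
  have e2 : criticalProbIOf graph (shiftIso v.1 ((0 : Site 2), v.2)) = criticalProbIOf graph ((0 : Site 2), v.2) :=
    Subtype.ext (criticalProb_iso (shiftIso v.1) _)
  have hv : shiftIso v.1 (((0 : Site 2), v.2) : Vtx) = v := by
    show ((0 : Site 2) + v.1, v.2) = v
    rw [zero_add]
  rw [← hv, e2, e1]
  exact h0

/-- **Conjecture 4 for the rotor lattice from the quasi-step node**: `p_c < 1` (p496890, unconditional) and `θ_v(p_c) = 0`. [cite: BenjaminiSchramm1996, Conj. 4] -/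
theorem conj4_of_quasiNode
    (hNode : ∀ {W : Type} (G : SimpleGraph W) [G.LocallyFinite] (Φ : PlanarSkeletonFrmQuasi G) (t : W) (D : ℕ),
      t ∈ Φ.types → Φ.HasProxies t D → Φ.CylSubcritical (criticalProbIOf G t) → theta G t (criticalProbIOf G t) = 0)
    (v : Vtx) : criticalProb graph v < 1 ∧ theta graph v (criticalProbIOf graph v) = 0 :=
  ⟨rotor_criticalProb_lt_one v, criticalContinuity_of_quasiNode hNode v⟩

end Z2Rot

end Summit.CriticalPhenomena.PercolationContinuityZ3.Theorems.Transplant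

end
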